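import Literature.NumberTheory.DiophantineGeometry.CatalanObstruction
import Literature.NumberTheory.DiophantineGeometry.CatalanCasselsBounds
import Mathlib.NumberTheory.NumberField.Cyclotomic.Galois
import Mathlib.NumberTheory.NumberField.Norm
import Mathlib.RingTheory.FractionalIdeal.Norm
import Mathlib.Analysis.SpecialFunctions.Complex.LogBounds
import HarnessLib

/-!
# The minus argument for Catalan's equation (Schoof, Chapter 11): Proposition 11.2 and the norm estimates

[Schoof2009, Chapter 11] proves Theorem III (`q < 4p²` and `p < 4q²`) for a non-zero solution of
`x^p - y^q = 1`, `p, q ≥ 5`, by an Archimedean argument. This file proves its two analytic /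
arithmetic ingredients for an *arbitrary* anti-symmetric exponent vector
`θ = ∑_a n_a σ_a⁻¹ ∈ ℤ[G]` (`n_{-a} = -n_a`), written as a function `θ : (ℤ/pℤ)ˣ → ℤ`, with
`(x - ζ)^θ := ∏_a (x - ζ^{a⁻¹})^{n_a}` and `‖θ‖ = ∑_a |n_a|`:

* `Catalan.norm_embedding_eq_one_of_pow_eq` and `Catalan.exists_pow_eq_one_norm_sub_le` —
  **[Schoof2009, Proposition 11.2]**: if `|x| ≥ 2` and `(x - ζ)^θ = α^q`, then for every embedding
  `φ : K → ℂ`, `|φ(α)| = 1` and there is a `q`-th root of unity `ξ` with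
  `|φ(α) - ξ| ≤ ‖θ‖ / (q (|x| - 1))` (via `L = ∑ n_a log(1 - φ(ζ^{a⁻¹})/x)`, `exp L = φ(α)^q`,
  `|L| ≤ ‖θ‖/(|x| - 1)`, `Re L = 0`);
* `Catalan.minusArgument` — the contradiction at the end of the proof of
  **[Schoof2009, Theorem III]**: for `p, q ≥ 5`, `q > 4p²`, a non-zero solution `(x, y)`, a
  non-zero anti-symmetric `θ` with `(p - 1)‖θ‖ ≤ 3q`, and `α ∈ K` with `(x - ζ)^θ = α^q` and
  `|φ(α) - 1| ≤ 3/((p-1)(|x|-1))` for one embedding `φ`, one gets a contradiction: `α ≠ 1`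
  ([Schoof2009, Lemma 11.1]: the ideals `𝔞_a` with `(x - ζ^{a⁻¹}) = 𝔭 𝔞_a^q` are pairwise
  coprime and non-trivial), `N(𝔄) |N(α - 1)| ≥ 1` for the integral ideal
  `𝔄 = ∏_{n_a < 0} 𝔞_a^{|n_a|}` with `𝔄 α ⊆ 𝓞_K`, `N(𝔄)^{2q} ≤ (|x|+1)^{(p-1)‖θ‖}` and
  `|N(α - 1)| ≤ 2^{p-3} (3/((p-1)(|x|-1)))²`, against `|x| ≥ q^{p-1} + q`
  (`Catalan.cassels_abs_x_ge`, [Schoof2009, Corollary 6.5]).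

The combinatorial part of Chapter 11 (Proposition 11.3, Lemma 11.4, Corollary 11.5) and the
assembly of Theorem III are in `CatalanTheoremIII`. Everything here is proved; no definitions, no
named facts.

## References

* R. Schoof, *Catalan's Conjecture*, Universitext, Springer 2009 [Schoof2009], Chapter 11:
  Lemma 11.1, Proposition 11.2, Theorem III (book pp. 75–80) — held,
  `lit read book:schoof2009-catalan-s-conjecture` (PDF pp. 151–155).
* P. Mihăilescu, *On the class groups of cyclotomic extensions in presence of a solution to
  Catalan's equation*, J. Number Theory **118** (2006), 123–144.
-/

namespace Literature.NumberTheory.DiophantineGeometry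

namespace Catalan

open Finset NumberField Complex

/-! ### Proposition 11.2: `φ(α)` is close to a `q`-th root of unity -/

section Prop112

variable {p : ℕ} [hp : Fact p.Prime] {K : Type*} [Field K] [NumberField K] {ζ : K}

/-- `‖log (1 + t)‖ ≤ ‖t‖ / (1 - ‖t‖)` for `‖t‖ < 1` ([Schoof2009, Exercise 11.1 (a)]).
[cite: Schoof2009, Exercise 11.1] -/
theorem norm_log_one_add_le_div {t : ℂ} (ht : ‖t‖ < 1) : ‖log (1 + t)‖ ≤ ‖t‖ / (1 - ‖t‖) := by
  have h := Complex.norm_log_one_add_le ht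
  have h1 : 0 < 1 - ‖t‖ := by linarith
  refine h.trans ?_
  rw [div_eq_mul_inv ‖t‖, ← sub_nonneg]
  have : ‖t‖ * (1 - ‖t‖)⁻¹ - (‖t‖ ^ 2 * (1 - ‖t‖)⁻¹ / 2 + ‖t‖) =
      ‖t‖ ^ 2 * (1 - ‖t‖)⁻¹ / 2 := by
    field_simp
    ring
  rw [this]
  positivity

/-- The sum of an anti-symmetric function on `(ℤ/pℤ)ˣ` vanishes. [folklore] -/
theorem sum_eq_zero_of_neg {M : Type*} [AddCommGroup M] [NoZeroSMulDivisors ℕ M]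
    (θ : (ZMod p)ˣ → M) (hanti : ∀ a, θ (-a) = -θ a) : ∑ a, θ a = 0 := by
  have h : ∑ a, θ a = -∑ a, θ a := by
    calc ∑ a, θ a = ∑ a, θ (-a) := (Fintype.sum_equiv (Equiv.neg _) _ _ fun a => rfl).symm
      _ = -∑ a, θ a := by rw [← Finset.sum_neg_distrib]; exact Finset.sum_congr rfl fun a _ => hanti a
  have h2 : (2 : ℕ) • ∑ a, θ a = 0 := by rw [two_nsmul]; nth_rewrite 2 [h]; exact add_neg_cancel _
  exact (smul_eq_zero.mp h2).resolve_left two_ne_zero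

/-- **[Schoof2009, Proposition 11.2], first half.** Let `|x| ≥ 2`, `θ : (ℤ/pℤ)ˣ → ℤ`
anti-symmetric (`θ(-a) = -θ(a)`, i.e. `θ ∈ (1 - ι)ℤ[G]`), and `α ∈ K` with
`α^q = (x - ζ)^θ = ∏_a (x - ζ^{a⁻¹})^{θ(a)}`, `q ≥ 1`. Then `|φ(α)| = 1` for every embedding
`φ : K → ℂ`. [cite: Schoof2009, Proposition 11.2] -/
theorem norm_embedding_eq_one_of_pow_eq (hζ : IsPrimitiveRoot ζ p) {x : ℤ} (hx : 2 ≤ |x|)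
    (θ : (ZMod p)ˣ → ℤ) (hanti : ∀ a, θ (-a) = -θ a) {q : ℕ} (hq : q ≠ 0) {α : K}
    (hα : α ^ q = ∏ a : (ZMod p)ˣ, ((x : K) - ζ ^ ((a⁻¹ : (ZMod p)ˣ) : ZMod p).val) ^ θ a)
    (φ : K →+* ℂ) : ‖φ α‖ = 1 := by
  haveI : NeZero p := ⟨hp.out.ne_zero⟩
  obtain ⟨ω, hω⟩ : ∃ ω : (ZMod p)ˣ → ℂ, ∀ a, ω a = φ ζ ^ ((a⁻¹ : (ZMod p)ˣ) : ZMod p).val :=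
    ⟨_, fun a => rfl⟩
  have hφζ : ‖φ ζ‖ = 1 := (hζ.map_of_injective φ.injective).norm'_eq_one hp.out.ne_zero
  have hωnorm : ∀ a, ‖ω a‖ = 1 := fun a => by rw [hω, norm_pow, hφζ, one_pow]
  have hX : (2 : ℝ) ≤ |(x : ℝ)| := by exact_mod_cast hx
  -- `ω (-a) = conj (ω a)`
  have hωneg : ∀ a, ω (-a) = (starRingEnd ℂ) (ω a) := by
    intro a
    have hj : ((a⁻¹ : (ZMod p)ˣ) : ZMod p).val ≤ p := (ZMod.val_lt _).le
    have hval : ((((-a)⁻¹ : (ZMod p)ˣ) : ZMod p)).val = p - ((a⁻¹ : (ZMod p)ˣ) : ZMod p).val := by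
      rw [inv_neg, Units.val_neg, ZMod.neg_val, if_neg (a⁻¹).ne_zero]
    rw [hω, hω, hval, ← Complex.inv_eq_conj (by rw [norm_pow, hφζ, one_pow])]
    refine eq_inv_of_mul_eq_one_left ?_
    rw [← pow_add, Nat.sub_add_cancel hj, (hζ.map_of_injective φ.injective).pow_eq_one]
  -- the factors `x - ω a` are non-zero with `‖x - ω(-a)‖ = ‖x - ω a‖`
  have hbase : ∀ a, (x : ℂ) - ω a ≠ 0 := by
    intro a h0
    have : ‖(x : ℂ)‖ = ‖ω a‖ := by rw [sub_eq_zero.mp h0]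
    rw [hωnorm, Complex.norm_intCast] at this
    have : (2 : ℝ) ≤ 1 := by
      calc (2 : ℝ) ≤ |(x : ℝ)| := hX
        _ = 1 := by exact_mod_cast this
    linarith
  have hnormneg : ∀ a, ‖(x : ℂ) - ω (-a)‖ = ‖(x : ℂ) - ω a‖ := by
    intro a
    rw [hωneg, ← Complex.norm_conj ((x : ℂ) - ω a), map_sub, map_intCast]
  -- `φ (α ^ q) = ∏_a (x - ω a) ^ θ a`, of norm `R` with `R = R⁻¹`
  have hφα : φ α ^ q = ∏ a, ((x : ℂ) - ω a) ^ θ a := by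
    rw [← map_pow, hα, map_prod]
    refine prod_congr rfl fun a _ => ?_
    rw [map_zpow₀, map_sub, map_intCast, map_pow, hω]
  set R : ℝ := ∏ a, ‖(x : ℂ) - ω a‖ ^ θ a with hR
  have hRpos : 0 < R := prod_pos fun a _ => zpow_pos (norm_pos_iff.mpr (hbase a)) _
  have hRinv : R = R⁻¹ := by
    calc R = ∏ a, ‖(x : ℂ) - ω (-a)‖ ^ θ (-a) :=
          (Fintype.prod_equiv (Equiv.neg _) _ _ fun a => rfl).symm
      _ = ∏ a, (‖(x : ℂ) - ω a‖ ^ θ a)⁻¹ := by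
          refine prod_congr rfl fun a _ => ?_
          rw [hnormneg, hanti, zpow_neg]
      _ = R⁻¹ := by rw [hR, Finset.prod_inv_distrib]
  have hR1 : R = 1 := by
    have h2 : R * R = 1 := by nth_rewrite 2 [hRinv]; exact mul_inv_cancel₀ hRpos.ne'
    nlinarith [hRpos]
  have hnq : ‖φ α‖ ^ q = 1 := by
    rw [← norm_pow, hφα, norm_prod]
    simp only [norm_zpow]
    exact hR1
  exact (pow_eq_one_iff_of_nonneg (norm_nonneg _) hq).mp hnq

/-- `∏_a c^{f a} = c^{∑ f a}` for integer exponents and `c ≠ 0`. [folklore] -/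
theorem prod_zpow_eq_zpow_sum {F : Type*} [Field F] {ι : Type*} (s : Finset ι) {c : F}
    (hc : c ≠ 0) (f : ι → ℤ) : ∏ a ∈ s, c ^ f a = c ^ ∑ a ∈ s, f a := by
  classical
  induction s using Finset.induction_on with
  | empty => simp
  | insert a s ha ih => rw [prod_insert ha, sum_insert ha, ih, zpow_add₀ hc]

/-- **[Schoof2009, Proposition 11.2].** Let `|x| ≥ 2`, `θ : (ℤ/pℤ)ˣ → ℤ` anti-symmetric,
`q ≥ 1` and `α ∈ K` with `α^q = (x - ζ)^θ = ∏_a (x - ζ^{a⁻¹})^{θ(a)}`. Then for every embedding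
`φ : K → ℂ` there is a `q`-th root of unity `ξ ∈ ℂ` with
`|φ(α) - ξ| ≤ ‖θ‖ / (q (|x| - 1))`, `‖θ‖ = ∑_a |θ(a)|`. [cite: Schoof2009, Proposition 11.2] -/
theorem exists_pow_eq_one_norm_sub_le (hζ : IsPrimitiveRoot ζ p) {x : ℤ} (hx : 2 ≤ |x|)
    (θ : (ZMod p)ˣ → ℤ) (hanti : ∀ a, θ (-a) = -θ a) {q : ℕ} (hq : q ≠ 0) {α : K}
    (hα : α ^ q = ∏ a : (ZMod p)ˣ, ((x : K) - ζ ^ ((a⁻¹ : (ZMod p)ˣ) : ZMod p).val) ^ θ a)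
    (φ : K →+* ℂ) :
    ∃ ξ : ℂ, ξ ^ q = 1 ∧ ‖φ α - ξ‖ ≤ (∑ a, |θ a| : ℤ) / (q * (|x| - 1) : ℝ) := by
  haveI : NeZero p := ⟨hp.out.ne_zero⟩
  have hnorm1 := norm_embedding_eq_one_of_pow_eq hζ hx θ hanti hq hα φ
  obtain ⟨ω, hω⟩ : ∃ ω : (ZMod p)ˣ → ℂ, ∀ a, ω a = φ ζ ^ ((a⁻¹ : (ZMod p)ˣ) : ZMod p).val :=
    ⟨_, fun a => rfl⟩
  have hφζ : ‖φ ζ‖ = 1 := (hζ.map_of_injective φ.injective).norm'_eq_one hp.out.ne_zero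
  have hωnorm : ∀ a, ‖ω a‖ = 1 := fun a => by rw [hω, norm_pow, hφζ, one_pow]
  set X : ℝ := |(x : ℝ)| with hXdef
  have hX : (2 : ℝ) ≤ X := by rw [hXdef]; exact_mod_cast hx
  have hx0 : (x : ℂ) ≠ 0 := by
    have : x ≠ 0 := by rintro rfl; simp at hx
    exact_mod_cast this
  have hxnorm : ‖(x : ℂ)‖ = X := by rw [Complex.norm_intCast]
  -- `t a = -ω a / x`, `‖t a‖ = 1/X`, `x - ω a = x (1 + t a)`
  set t : (ZMod p)ˣ → ℂ := fun a => -ω a / x with ht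
  have htnorm : ∀ a, ‖t a‖ = 1 / X := fun a => by
    simp only [ht, norm_div, norm_neg, hωnorm, hxnorm]
  have ht1 : ∀ a, ‖t a‖ < 1 := fun a => by rw [htnorm, div_lt_one (by linarith)]; linarith
  have hfac : ∀ a, (x : ℂ) - ω a = x * (1 + t a) := fun a => by
    simp only [ht]; field_simp; ring
  have h1t : ∀ a, 1 + t a ≠ 0 := fun a h0 => by
    have := norm_sub_norm_le (1 : ℂ) (-t a)
    rw [sub_neg_eq_add, h0, norm_zero, norm_one, norm_neg, htnorm] at this
    have : (1 : ℝ) ≤ 1 / X := by linarith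
    rw [le_div_iff₀ (by linarith)] at this
    linarith
  -- `φ α ^ q = ∏_a (1 + t a) ^ θ a`
  have hsum0 : ∑ a, θ a = 0 := sum_eq_zero_of_neg θ hanti
  have hφα : φ α ^ q = ∏ a, (1 + t a) ^ θ a := by
    rw [← map_pow, hα, map_prod]
    have : ∀ a, φ (((x : K) - ζ ^ ((a⁻¹ : (ZMod p)ˣ) : ZMod p).val) ^ θ a) =
        (x : ℂ) ^ θ a * (1 + t a) ^ θ a := fun a => by
      rw [map_zpow₀, map_sub, map_intCast, map_pow, ← hω, hfac, mul_zpow]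
    rw [prod_congr rfl (fun a _ => this a), prod_mul_distrib, prod_zpow_eq_zpow_sum _ hx0, hsum0,
      zpow_zero, one_mul]
  -- `L = ∑ θ a log (1 + t a)`, `exp L = φ α ^ q`, `‖L‖ ≤ ‖θ‖ / (X - 1)`
  set L : ℂ := ∑ a, (θ a : ℂ) * log (1 + t a) with hLdef
  have hexpL : exp L = φ α ^ q := by
    rw [hLdef, Complex.exp_sum, hφα]
    refine prod_congr rfl fun a _ => ?_
    rw [Complex.exp_int_mul, Complex.exp_log (h1t a)]
  set S : ℤ := ∑ a, |θ a| with hSdef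
  have hLnorm : ‖L‖ ≤ S / (X - 1) := by
    have hterm : ∀ a, ‖(θ a : ℂ) * log (1 + t a)‖ ≤ |(θ a : ℝ)| * (1 / (X - 1)) := by
      intro a
      rw [norm_mul, Complex.norm_intCast]
      refine mul_le_mul_of_nonneg_left ?_ (abs_nonneg _)
      refine (norm_log_one_add_le_div (ht1 a)).trans (le_of_eq ?_)
      rw [htnorm]
      field_simp
    calc ‖L‖ ≤ ∑ a, ‖(θ a : ℂ) * log (1 + t a)‖ := norm_sum_le _ _
      _ ≤ ∑ a, |(θ a : ℝ)| * (1 / (X - 1)) := sum_le_sum fun a _ => hterm a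
      _ = S / (X - 1) := by
          rw [← Finset.sum_mul, hSdef]
          push_cast
          ring
  -- `Re L = 0`
  have hLre : L.re = 0 := by
    have h1 : Real.exp L.re = 1 := by
      rw [← Complex.norm_exp, hexpL, norm_pow, hnorm1, one_pow]
    exact Real.exp_eq_one_iff _ |>.mp h1
  have hLim : L = (L.im : ℂ) * I := by
    conv_lhs => rw [← Complex.re_add_im L, hLre]
    simp
  -- `ξ = φ α · exp (-L/q)`
  refine ⟨φ α * exp (-(L / q)), ?_, ?_⟩
  · rw [mul_pow, ← Complex.exp_nat_mul, ← hexpL, ← Complex.exp_add]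
    have hq0 : (q : ℂ) ≠ 0 := Nat.cast_ne_zero.mpr hq
    rw [show L + (q : ℂ) * -(L / q) = 0 by field_simp; ring, Complex.exp_zero]
  · have hq0 : (0 : ℝ) < q := Nat.cast_pos.mpr (Nat.pos_of_ne_zero hq)
    have hrew : -(L / q) = I * ((-(L.im / q) : ℝ) : ℂ) := by
      rw [hLim]
      push_cast
      simp only [Complex.mul_im, Complex.ofReal_re, Complex.ofReal_im, Complex.I_re, Complex.I_im]
      ring_nf
    calc ‖φ α - φ α * exp (-(L / q))‖ = ‖φ α‖ * ‖exp (I * ((-(L.im / q) : ℝ) : ℂ)) - 1‖ := by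
          rw [← norm_mul, mul_sub, mul_one, ← hrew, norm_sub_rev]
      _ ≤ 1 * ‖(-(L.im / q) : ℝ)‖ :=
          mul_le_mul (le_of_eq hnorm1) Real.norm_exp_I_mul_ofReal_sub_one_le (norm_nonneg _)
            zero_le_one
      _ = |L.im| / q := by rw [one_mul, Real.norm_eq_abs, abs_neg, abs_div, Nat.abs_cast]
      _ ≤ ‖L‖ / q := by gcongr; exact Complex.abs_im_le_norm L
      _ ≤ (S / (X - 1)) / q := by gcongr
      _ = S / (q * (|x| - 1)) := by rw [hXdef, div_div, mul_comm, Int.cast_abs]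

/-! ### Norms through the complex embeddings -/

/-- `|N_{K/ℚ}(β)| ≤ B^{[K:ℚ]}` when `|ψ(β)| ≤ B` for all embeddings `ψ`. [folklore] -/
theorem abs_norm_le_pow_of_forall_embedding {β : K} {B : ℝ}
    (h : ∀ ψ : K →+* ℂ, ‖ψ β‖ ≤ B) :
    |((Algebra.norm ℚ β : ℚ) : ℝ)| ≤ B ^ Module.finrank ℚ K := by
  have hprod := Algebra.norm_eq_prod_embeddings ℚ ℂ β
  have hn : ‖(algebraMap ℚ ℂ) (Algebra.norm ℚ β)‖ = |((Algebra.norm ℚ β : ℚ) : ℝ)| := by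
    rw [eq_ratCast, Complex.norm_ratCast]
  rw [← hn, hprod, norm_prod, ← AlgHom.card ℚ K ℂ, ← Finset.card_univ, ← prod_const]
  exact prod_le_prod (fun ψ _ => norm_nonneg _) fun ψ _ => h ψ.toRingHom

/-- `B^{[K:ℚ]} ≤ |N_{K/ℚ}(β)|` when `B ≤ |ψ(β)|` for all embeddings `ψ` (`B ≥ 0`). [folklore] -/
theorem pow_le_abs_norm_of_forall_embedding {β : K} {B : ℝ} (hB : 0 ≤ B)
    (h : ∀ ψ : K →+* ℂ, B ≤ ‖ψ β‖) :
    B ^ Module.finrank ℚ K ≤ |((Algebra.norm ℚ β : ℚ) : ℝ)| := by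
  have hprod := Algebra.norm_eq_prod_embeddings ℚ ℂ β
  have hn : ‖(algebraMap ℚ ℂ) (Algebra.norm ℚ β)‖ = |((Algebra.norm ℚ β : ℚ) : ℝ)| := by
    rw [eq_ratCast, Complex.norm_ratCast]
  rw [← hn, hprod, norm_prod, ← AlgHom.card ℚ K ℂ, ← Finset.card_univ, ← prod_const]
  exact prod_le_prod (fun ψ _ => hB) fun ψ _ => h ψ.toRingHom

/-- The norm of the principal ideal `(r)` of `𝓞 K`, as a real number, is `|N_{K/ℚ}(r)|`.
[folklore] -/
theorem absNorm_span_singleton_eq_abs_norm (r : 𝓞 K) :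
    ((Ideal.absNorm (Ideal.span {r}) : ℕ) : ℝ) = |((Algebra.norm ℚ (r : K) : ℚ) : ℝ)| := by
  rw [Ideal.absNorm_span_singleton, ← Algebra.coe_norm_int, Nat.cast_natAbs, Int.cast_abs]
  norm_cast

/-- For an integer `x` and `ω ∈ K` of absolute value `1` under every embedding (e.g. a root of
unity): `(|x| - 1)^{[K:ℚ]} ≤ |N(x - ω)| ≤ (|x| + 1)^{[K:ℚ]}`. [cite: Schoof2009, Lemma 11.1 (proof)] -/
theorem abs_norm_intCast_sub_le {x : ℤ} (hx : 1 ≤ |x|) {ω : K} (hω : ∀ ψ : K →+* ℂ, ‖ψ ω‖ = 1) :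
    (|(x : ℝ)| - 1) ^ Module.finrank ℚ K ≤ |((Algebra.norm ℚ ((x : K) - ω) : ℚ) : ℝ)| ∧
      |((Algebra.norm ℚ ((x : K) - ω) : ℚ) : ℝ)| ≤ (|(x : ℝ)| + 1) ^ Module.finrank ℚ K := by
  have hx' : (1 : ℝ) ≤ |(x : ℝ)| := by exact_mod_cast hx
  constructor
  · refine pow_le_abs_norm_of_forall_embedding (by linarith) fun ψ => ?_
    rw [map_sub, map_intCast]
    have := norm_sub_norm_le (x : ℂ) (ψ ω)
    rw [Complex.norm_intCast, hω] at this
    linarith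
  · refine abs_norm_le_pow_of_forall_embedding fun ψ => ?_
    rw [map_sub, map_intCast]
    refine (norm_sub_le _ _).trans ?_
    rw [Complex.norm_intCast, hω]

end Prop112

/-! ### The contradiction ([Schoof2009, Lemma 11.1 and proof of Theorem III]) -/

section MinusArgument

variable {p : ℕ} [hp : Fact p.Prime] {K : Type*} [Field K] [NumberField K]
  [IsCyclotomicExtension {p} ℚ K] {ζ : K}

open scoped Pointwise nonZeroDivisors

/-- The numerical endgame of [Schoof2009, proof of Theorem III]: with `P₁ = p - 1 ≥ 4`,
`Y = |x| - 1 ≥ 16 · 4^{p-3}`, `B P₁ Y = 3`, the inequality `1 ≤ (Y+2)³ (B² 2^{p-3})²` is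
impossible. [cite: Schoof2009, Theorem III (proof, final inequalities)] -/
theorem minusArgument_numeric {P Y F B T : ℝ} (hP : 5 ≤ P) (hY9 : 9 ≤ Y) (hF0 : 0 < F)
    (hYF : 16 * F ≤ Y) (hB : B * ((P - 1) * Y) = 3) (hT : T ^ 2 = F)
    (h5 : 1 ≤ (Y + 2) ^ 3 * (B ^ 2 * T) ^ 2) : False := by
  have hY0 : 0 < Y := by linarith
  have hPY : 0 < (P - 1) * Y := mul_pos (by linarith) hY0
  -- multiply by `((P-1) Y)^4`: `((P-1) Y)^4 ≤ 81 F (Y+2)^3`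
  have e : (Y + 2) ^ 3 * (B ^ 2 * T) ^ 2 * ((P - 1) * Y) ^ 4 = 81 * F * (Y + 2) ^ 3 := by
    have : (B ^ 2 * T) ^ 2 * ((P - 1) * Y) ^ 4 = (B * ((P - 1) * Y)) ^ 4 * T ^ 2 := by ring
    rw [mul_assoc, this, hB, hT]
    ring
  have key : ((P - 1) * Y) ^ 4 ≤ 81 * F * (Y + 2) ^ 3 := by
    have := mul_le_mul_of_nonneg_right h5 (pow_nonneg hPY.le 4)
    rwa [one_mul, e] at this
  have hcube : (Y + 2) ^ 3 ≤ 2 * Y ^ 3 := by nlinarith [sq_nonneg Y, sq_nonneg (Y - 9)]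
  have h7 : (4 * Y) ^ 4 ≤ ((P - 1) * Y) ^ 4 :=
    pow_le_pow_left₀ (by positivity) (mul_le_mul_of_nonneg_right (by linarith) hY0.le) 4
  have h8 : 81 * F * (Y + 2) ^ 3 < (4 * Y) ^ 4 := by
    calc 81 * F * (Y + 2) ^ 3 ≤ 81 * F * (2 * Y ^ 3) :=
          mul_le_mul_of_nonneg_left hcube (by positivity)
      _ < (128 * (16 * F)) * Y ^ 3 := by nlinarith [pow_pos hY0 3]
      _ ≤ (128 * Y) * Y ^ 3 :=
          mul_le_mul_of_nonneg_right (by linarith) (by positivity)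
      _ ≤ (4 * Y) ^ 4 := by nlinarith [pow_pos hY0 3]
  linarith

set_option maxHeartbeats 400000 in
/-- **The minus argument** ([Schoof2009, proof of Theorem III, pp. 78–79], with
[Schoof2009, Lemma 11.1]). Let `p, q ≥ 5` be primes with `q > 4p²`, `x, y` non-zero integers
with `x^p - y^q = 1`, `K` a `p`-th cyclotomic field with primitive root `ζ`. Suppose
`θ : (ℤ/pℤ)ˣ → ℤ` is anti-symmetric and non-zero with `(p-1)‖θ‖ ≤ 3q`, that `α ∈ K` satisfies
`α^q = (x - ζ)^θ = ∏_a (x - ζ^{a⁻¹})^{θ(a)}`, and that `|φ(α) - 1| ≤ 3/((p-1)(|x|-1))` for some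
embedding `φ : K → ℂ`. Then we reach a contradiction: `α ≠ 1` by Lemma 11.1 (the ideals `𝔞_a`
with `(x - ζ^{a⁻¹}) = 𝔭 𝔞_a^q` are pairwise coprime and `≠ (1)`), the integral ideal
`𝔄 = ∏_{θ(a) < 0} 𝔞_a^{|θ(a)|}` satisfies `𝔄 α ⊆ 𝓞_K`, so `N(𝔄) |N(α - 1)| ≥ 1`, while
`N(𝔄)^{2q} ≤ (|x|+1)^{(p-1)‖θ‖} ≤ (|x|+1)^{3q}` and
`|N(α - 1)| ≤ 2^{p-3} (3/((p-1)(|x|-1)))²` (all embeddings of `α` have absolute value `1`,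
Proposition 11.2, and `φ`, `φ̄` are close to `1`); this is impossible as
`|x| ≥ q^{p-1} + q` ([Schoof2009, Corollary 6.5]). [cite: Schoof2009, Theorem III (proof)] -/
theorem minusArgument (hζ : IsPrimitiveRoot ζ p) {q : ℕ} (hq : q.Prime) (hp5 : 5 ≤ p)
    (h4 : 4 * p ^ 2 < q) {x y : ℤ} (hx : x ≠ 0) (hy : y ≠ 0) (h : x ^ p - y ^ q = 1)
    (θ : (ZMod p)ˣ → ℤ) (hanti : ∀ a, θ (-a) = -θ a) (hθ0 : ∃ a, θ a ≠ 0)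
    (hsize : ((p - 1 : ℕ) : ℤ) * ∑ a, |θ a| ≤ 3 * q) {α : K}
    (hα : α ^ q = ∏ a : (ZMod p)ˣ, ((x : K) - ζ ^ ((a⁻¹ : (ZMod p)ˣ) : ZMod p).val) ^ θ a)
    (φ : K →+* ℂ) (hφ : ‖φ α - 1‖ ≤ 3 / (((p : ℝ) - 1) * (|(x : ℝ)| - 1))) : False := by
  classical
  -- ### elementary facts about `p`, `q`, `x`
  haveI : Fact (1 < p) := ⟨hp.out.one_lt⟩
  haveI : NeZero p := ⟨hp.out.ne_zero⟩
  have hp2 : p ≠ 2 := by omega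
  have hpo : Odd p := hp.out.odd_of_ne_two hp2
  have hq5 : 5 ≤ q := by nlinarith
  have hqo : Odd q := hq.odd_of_ne_two (by omega)
  have hX0 := cassels_abs_x_ge hp.out hq hpo hqo hx hy h
  set X : ℝ := |(x : ℝ)| with hXdef
  have hq4 : (4 : ℤ) ≤ q := by exact_mod_cast (show 4 ≤ q by omega)
  have hXq : (4 : ℝ) ^ (p - 1) + 4 ≤ X := by
    have h1 : (4 : ℤ) ^ (p - 1) + 4 ≤ |x| :=
      le_trans (add_le_add (pow_le_pow_left₀ (by norm_num) hq4 _) hq4) hX0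
    have h2 : ((4 : ℤ) ^ (p - 1) + 4 : ℤ) ≤ (|x| : ℤ) := h1
    have h3 : (((4 : ℤ) ^ (p - 1) + 4 : ℤ) : ℝ) ≤ ((|x| : ℤ) : ℝ) := by exact_mod_cast h2
    simpa [hXdef] using h3
  have h4p : (256 : ℝ) ≤ (4 : ℝ) ^ (p - 1) := by
    calc (256 : ℝ) = 4 ^ 4 := by norm_num
      _ ≤ 4 ^ (p - 1) := pow_le_pow_right₀ (by norm_num) (by omega)
  have hX10 : (10 : ℝ) ≤ X := by linarith
  have hx2 : 2 ≤ |x| := by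
    have : (2 : ℝ) ≤ |(x : ℝ)| := by linarith
    exact_mod_cast this
  have hx1 : 1 ≤ |x| := by linarith
  -- ### the ideals `𝔟 a` with `(x - z^(m a)) = 𝔭 · (𝔟 a)^q`
  set z : 𝓞 K := hζ.toInteger with hzdef
  have hz : IsPrimitiveRoot z p := hζ.toInteger_isPrimitiveRoot
  have hzp : z ^ p = 1 := hz.pow_eq_one
  have hzK : algebraMap (𝓞 K) K z = ζ := hζ.coe_toInteger
  set 𝔭 : Ideal (𝓞 K) := Ideal.span {z - 1} with h𝔭def
  have hπprime : Prime (z - 1) := by rw [hzdef]; exact hζ.zeta_sub_one_prime'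
  have h𝔭prime : 𝔭.IsPrime := (Ideal.span_singleton_prime hπprime.ne_zero).mpr hπprime
  have h𝔭0 : 𝔭 ≠ ⊥ := by
    rw [h𝔭def, Ne, Ideal.span_singleton_eq_bot]; exact hπprime.ne_zero
  have h𝔭max : 𝔭.IsMaximal := h𝔭prime.isMaximal h𝔭0
  have h𝔭norm : Ideal.absNorm 𝔭 = p := by
    rw [h𝔭def, Ideal.absNorm_span_singleton, hzdef,
      hζ.norm_toInteger_sub_one_of_prime_ne_two' hp2, Int.natAbs_natCast]
  set m : (ZMod p)ˣ → ℕ := fun a => ((a⁻¹ : (ZMod p)ˣ) : ZMod p).val with hmdef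
  have hm1 : ∀ a, 1 ≤ m a := fun a => by
    rw [hmdef]; simp only
    rw [Nat.one_le_iff_ne_zero, Ne, ZMod.val_eq_zero]
    exact (a⁻¹).ne_zero
  have hmp : ∀ a, m a < p := fun a => ZMod.val_lt _
  have hmIco : ∀ a, m a ∈ Ico 1 p := fun a => mem_Ico.mpr ⟨hm1 a, hmp a⟩
  have hminj : ∀ {a b}, m a = m b → a = b := by
    intro a b hab
    have : ((a⁻¹ : (ZMod p)ˣ) : ZMod p) = ((b⁻¹ : (ZMod p)ˣ) : ZMod p) := by
      rw [← ZMod.natCast_zmod_val ((a⁻¹ : (ZMod p)ˣ) : ZMod p), ← ZMod.natCast_zmod_val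
        ((b⁻¹ : (ZMod p)ˣ) : ZMod p)]
      exact congrArg Nat.cast hab
    exact inv_injective (Units.ext this)
  obtain ⟨𝔞f, h𝔞f⟩ := span_sub_zeta_pow_eq hζ hq hpo hqo hx hy h
  set 𝔟 : (ZMod p)ˣ → Ideal (𝓞 K) := fun a => 𝔞f (m a) with h𝔟def
  have h𝔟 : ∀ a, Ideal.span {(x : 𝓞 K) - z ^ m a} = 𝔭 * 𝔟 a ^ q := fun a => (h𝔞f (m a) (hmIco a)).1
  have h𝔟cop : ∀ a, IsCoprime 𝔭 (𝔟 a) := fun a => (h𝔞f (m a) (hmIco a)).2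
  have h𝔟0 : ∀ a, 𝔟 a ≠ ⊥ := by
    intro a h0
    have := h𝔟 a
    rw [h0, ← Ideal.zero_eq_bot, zero_pow hq.ne_zero, mul_zero, Ideal.zero_eq_bot,
      Ideal.span_singleton_eq_bot, sub_eq_zero] at this
    have h1 := congrArg (algebraMap (𝓞 K) K) this
    rw [map_intCast, map_pow, hzK] at h1
    -- `x = ζ^(m a)` is absurd: `|φ x| = |x| ≥ 2` but `|φ ζ^j| = 1`
    have h3 : ‖φ ((x : K))‖ = 1 := by
      rw [h1, map_pow, norm_pow, (hζ.map_of_injective φ.injective).norm'_eq_one hp.out.ne_zero,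
        one_pow]
    rw [map_intCast, Complex.norm_intCast] at h3
    have : (2 : ℝ) ≤ 1 := by
      calc (2 : ℝ) ≤ |(x : ℝ)| := by exact_mod_cast hx2
        _ = 1 := h3
    linarith
  have hmem𝔟 : ∀ a, (x : 𝓞 K) - z ^ m a ∈ 𝔟 a := by
    intro a
    have : Ideal.span {(x : 𝓞 K) - z ^ m a} ≤ 𝔟 a := by
      rw [h𝔟 a]
      exact Ideal.mul_le_left.trans (Ideal.pow_le_self hq.ne_zero)
    exact this (Ideal.mem_span_singleton_self _)
  -- norms: `p · N(𝔟 a)^q = N(x - z^(m a))` and `(X-1)^(p-1) ≤ N(x - z^(m a)) ≤ (X+1)^(p-1)`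
  have hrank : Module.finrank ℚ K = p - 1 := by
    rw [IsCyclotomicExtension.Rat.finrank p K, Nat.totient_prime hp.out]
  have hωnorm : ∀ (j : ℕ) (ψ : K →+* ℂ), ‖ψ (ζ ^ j)‖ = 1 := fun j ψ => by
    rw [map_pow, norm_pow, (hζ.map_of_injective ψ.injective).norm'_eq_one hp.out.ne_zero, one_pow]
  have hνeq : ∀ a, (Ideal.absNorm (Ideal.span {(x : 𝓞 K) - z ^ m a}) : ℝ) =
      |((Algebra.norm ℚ ((x : K) - ζ ^ m a) : ℚ) : ℝ)| := by
    intro a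
    rw [absNorm_span_singleton_eq_abs_norm]
    congr 2
  have hνle : ∀ a, (Ideal.absNorm (Ideal.span {(x : 𝓞 K) - z ^ m a}) : ℝ) ≤ (X + 1) ^ (p - 1) := by
    intro a
    rw [hνeq, ← hrank]
    exact (abs_norm_intCast_sub_le hx1 (hωnorm (m a))).2
  have hνge : ∀ a, (X - 1) ^ (p - 1) ≤ (Ideal.absNorm (Ideal.span {(x : 𝓞 K) - z ^ m a}) : ℝ) := by
    intro a
    rw [hνeq, ← hrank]
    exact (abs_norm_intCast_sub_le hx1 (hωnorm (m a))).1
  have hνfac : ∀ a, Ideal.absNorm (Ideal.span {(x : 𝓞 K) - z ^ m a}) = p * Ideal.absNorm (𝔟 a) ^ q := by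
    intro a
    rw [h𝔟 a, map_mul, map_pow, h𝔭norm]
  -- `𝔟 a ≠ ⊤`
  have h𝔟top : ∀ a, 𝔟 a ≠ ⊤ := by
    intro a htop
    have h1 := hνfac a
    rw [htop, ← Ideal.one_eq_top, map_one, one_pow, mul_one] at h1
    have h2 := hνge a
    rw [h1] at h2
    -- `(X - 1)^(p-1) ≤ p` is absurd
    have h3 : (4 : ℝ) ^ (p - 1) ≤ (X - 1) ^ (p - 1) := pow_le_pow_left₀ (by norm_num) (by linarith) _
    have h5 : (p : ℝ) < 4 ^ (p - 1) := by
      have : p < 4 ^ (p - 1) := by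
        have hind : ∀ n : ℕ, n + 2 < 4 ^ (n + 1) := fun n => by
          induction n with
          | zero => norm_num
          | succ n ih => rw [pow_succ]; omega
        have := hind (p - 2)
        rwa [show p - 2 + 2 = p by omega, show p - 2 + 1 = p - 1 by omega] at this
      exact_mod_cast this
    linarith
  -- pairwise coprimality of the `𝔟 a` ([Schoof2009, Lemma 11.1])
  have hzunit : IsUnit z := hz.isUnit hp.out.ne_zero
  have h𝔟copr : ∀ a b, a ≠ b → IsCoprime (𝔟 a) (𝔟 b) := by
    intro a b hab
    rw [Ideal.isCoprime_iff_sup_eq]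
    by_contra hne
    obtain ⟨M, hM, hle⟩ := Ideal.exists_le_maximal _ hne
    have haM : (x : 𝓞 K) - z ^ m a ∈ M := hle (Ideal.mem_sup_left (hmem𝔟 a))
    have hbM : (x : 𝓞 K) - z ^ m b ∈ M := hle (Ideal.mem_sup_right (hmem𝔟 b))
    have hdiff : z ^ m b - z ^ m a ∈ M := by
      have := M.sub_mem haM hbM
      rwa [sub_sub_sub_cancel_left] at this
    -- `z^(m b) - z^(m a)` is associated to `z - 1`
    have hzM : z - 1 ∈ M := by
      rcases Nat.lt_or_ge (m a) (m b) with hlt | hge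
      · have hd : (m b - m a).Coprime p :=
          (Nat.coprime_of_lt_prime (by omega) (by have := hmp b; omega) hp.out).symm
        obtain ⟨u, hu⟩ := hz.associated_sub_one_pow_sub_one_of_coprime hd
        have : z ^ m b - z ^ m a = z ^ m a * (z ^ (m b - m a) - 1) := by
          rw [mul_sub, mul_one, ← pow_add, Nat.add_sub_cancel' hlt.le]
        rw [this] at hdiff
        have h2 := (hM.isPrime.mem_or_mem hdiff).resolve_left fun hz' =>
          hM.ne_top (M.eq_top_of_isUnit_mem hz' (hzunit.pow _))
        rw [← hu] at h2
        exact (hM.isPrime.mem_or_mem h2).resolve_right fun hu' =>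
          hM.ne_top (M.eq_top_of_isUnit_mem hu' u.isUnit)
      · have hne' : m a ≠ m b := fun h => hab (hminj h)
        have hgt : m b < m a := lt_of_le_of_ne hge (Ne.symm hne')
        have hd : (m a - m b).Coprime p :=
          (Nat.coprime_of_lt_prime (by omega) (by have := hmp a; omega) hp.out).symm
        obtain ⟨u, hu⟩ := hz.associated_sub_one_pow_sub_one_of_coprime hd
        have : z ^ m b - z ^ m a = -(z ^ m b * (z ^ (m a - m b) - 1)) := by
          rw [mul_sub, mul_one, ← pow_add, Nat.add_sub_cancel' hgt.le, neg_sub]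
        rw [this, neg_mem_iff] at hdiff
        have h2 := (hM.isPrime.mem_or_mem hdiff).resolve_left fun hz' =>
          hM.ne_top (M.eq_top_of_isUnit_mem hz' (hzunit.pow _))
        rw [← hu] at h2
        exact (hM.isPrime.mem_or_mem h2).resolve_right fun hu' =>
          hM.ne_top (M.eq_top_of_isUnit_mem hu' u.isUnit)
    have h𝔭M : 𝔭 = M := h𝔭max.eq_of_le hM.ne_top (by
      rw [h𝔭def, Ideal.span_singleton_le_iff_mem]; exact hzM)
    have : 𝔭 ⊔ 𝔟 a = ⊤ := Ideal.isCoprime_iff_sup_eq.mp (h𝔟cop a)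
    rw [h𝔭M, sup_eq_left.mpr (le_sup_left.trans hle)] at this
    exact hM.ne_top this
  -- ### positive and negative parts of `θ`; `Wp`, `Wm`
  set θp : (ZMod p)ˣ → ℕ := fun a => (θ a).toNat with hθpdef
  set θm : (ZMod p)ˣ → ℕ := fun a => (-θ a).toNat with hθmdef
  have hθpm : ∀ a, θ a = (θp a : ℤ) - θm a := fun a => (Int.toNat_sub_toNat_neg (θ a)).symm
  have hθabs : ∀ a, |θ a| = (θp a : ℤ) + θm a := fun a => by
    rw [hθpdef, hθmdef]
    simp only
    rw [← Nat.cast_add, Int.toNat_add_toNat_neg_eq_natAbs, Int.natCast_natAbs]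
  have hθmneg : ∀ a, θm (-a) = θp a := fun a => by
    simp only [hθmdef, hθpdef, hanti, neg_neg]
  set H : ℕ := ∑ a, θm a with hHdef
  have hHp : ∑ a, θp a = H := by
    rw [hHdef]
    calc ∑ a, θp a = ∑ a, θm (-a) := by simp_rw [hθmneg]
      _ = ∑ a, θm a := Fintype.sum_equiv (Equiv.neg _) _ _ fun a => rfl
  have hS : ∑ a, |θ a| = 2 * (H : ℤ) := by
    simp_rw [hθabs]
    rw [sum_add_distrib, ← Nat.cast_sum, ← Nat.cast_sum, hHp, hHdef]
    ring
  have hHq : 2 * (p - 1) * H ≤ 3 * q := by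
    have h1 : ((p - 1 : ℕ) : ℤ) * (2 * (H : ℤ)) ≤ 3 * q := by rwa [← hS]
    have h2 : (((p - 1) * (2 * H) : ℕ) : ℤ) ≤ ((3 * q : ℕ) : ℤ) := by push_cast; linarith
    have h3 := Int.ofNat_le.mp h2
    nlinarith
  -- an index with `θ a₀ > 0`
  obtain ⟨a₀, ha₀⟩ : ∃ a₀, 0 < θ a₀ := by
    obtain ⟨a, ha⟩ := hθ0
    rcases lt_or_gt_of_ne ha with h1 | h1
    · exact ⟨-a, by rw [hanti]; linarith⟩
    · exact ⟨a, h1⟩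
  have hθpa₀ : 1 ≤ θp a₀ := by
    have : (θp a₀ : ℤ) = θ a₀ := Int.toNat_of_nonneg ha₀.le
    omega
  have hθma₀ : θm a₀ = 0 := by
    simp only [hθmdef, Int.toNat_eq_zero]; linarith
  -- the factors `x - z^(m a)` and the elements `Wp`, `Wm`
  have hfac0 : ∀ a, (x : 𝓞 K) - z ^ m a ≠ 0 := by
    intro a h0
    have := h𝔟 a
    rw [h0, Ideal.span_singleton_zero] at this
    exact (mul_ne_zero h𝔭0 (pow_ne_zero _ (h𝔟0 a))) this.symm
  set Wp : 𝓞 K := ∏ a, ((x : 𝓞 K) - z ^ m a) ^ θp a with hWpdef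
  set Wm : 𝓞 K := ∏ a, ((x : 𝓞 K) - z ^ m a) ^ θm a with hWmdef
  have hWp0 : Wp ≠ 0 := prod_ne_zero_iff.mpr fun a _ => pow_ne_zero _ (hfac0 a)
  have hWm0 : Wm ≠ 0 := prod_ne_zero_iff.mpr fun a _ => pow_ne_zero _ (hfac0 a)
  have hι0 : ∀ {w : 𝓞 K}, w ≠ 0 → algebraMap (𝓞 K) K w ≠ 0 := fun hw =>
    RingOfIntegers.coe_ne_zero_iff.mpr hw
  have hιfac : ∀ a, algebraMap (𝓞 K) K ((x : 𝓞 K) - z ^ m a) = (x : K) - ζ ^ m a := fun a => by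
    rw [map_sub, map_intCast, map_pow, hzK]
  have hαW : α ^ q = algebraMap (𝓞 K) K Wp / algebraMap (𝓞 K) K Wm := by
    rw [hα, hWpdef, hWmdef, map_prod, map_prod, ← prod_div_distrib]
    refine prod_congr rfl fun a _ => ?_
    rw [map_pow, map_pow, hιfac, hθpm a, zpow_sub₀ (by rw [← hιfac]; exact hι0 (hfac0 a)),
      zpow_natCast, zpow_natCast]
  -- ### the ideals `Ap = ∏ 𝔟^θp`, `Am = ∏ 𝔟^θm`: `(W±) = 𝔭^H 𝔄±^q`
  set Ap : Ideal (𝓞 K) := ∏ a, 𝔟 a ^ θp a with hApdef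
  set Am : Ideal (𝓞 K) := ∏ a, 𝔟 a ^ θm a with hAmdef
  have hAm0 : Am ≠ ⊥ := by
    rw [hAmdef, ← Ideal.zero_eq_bot, prod_ne_zero_iff]
    exact fun a _ => pow_ne_zero _ (by rw [Ideal.zero_eq_bot]; exact h𝔟0 a)
  have hideal : ∀ e : (ZMod p)ˣ → ℕ,
      Ideal.span {∏ a, ((x : 𝓞 K) - z ^ m a) ^ e a} = 𝔭 ^ (∑ a, e a) * (∏ a, 𝔟 a ^ e a) ^ q := by
    intro e
    rw [← Ideal.prod_span_singleton]
    simp_rw [← Ideal.span_singleton_pow, h𝔟, mul_pow, prod_mul_distrib, prod_pow_eq_pow_sum,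
      ← prod_pow, ← pow_mul, mul_comm q]
  have hWpideal : Ideal.span {Wp} = 𝔭 ^ H * Ap ^ q := by rw [hWpdef, hideal, hHp]
  have hWmideal : Ideal.span {Wm} = 𝔭 ^ H * Am ^ q := by rw [hWmdef, hideal]
  -- ### `α ≠ 1` ([Schoof2009, Lemma 11.1])
  have hα1 : α ≠ 1 := by
    intro hα1
    have hWW : Wp = Wm := by
      apply FaithfulSMul.algebraMap_injective (𝓞 K) K
      rw [hα1, one_pow, eq_div_iff (hι0 hWm0), one_mul] at hαW
      exact hαW.symm
    have h𝔄q : Ap ^ q = Am ^ q := by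
      apply mul_left_cancel₀ (pow_ne_zero H h𝔭0)
      rw [← hWpideal, ← hWmideal, hWW]
    -- `𝔟 a₀ ∣ Ap^q = Am^q`, but `𝔟 a₀` is coprime to `Am^q`
    have hdvd : 𝔟 a₀ ∣ Am ^ q := by
      rw [← h𝔄q]
      refine dvd_pow ?_ hq.ne_zero
      rw [hApdef]
      exact (dvd_pow_self _ (by omega)).trans (Finset.dvd_prod_of_mem _ (mem_univ a₀))
    have hcopq : IsCoprime (𝔟 a₀) (Am ^ q) := by
      refine IsCoprime.pow_right ?_
      rw [hAmdef]
      refine IsCoprime.prod_right fun b _ => ?_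
      by_cases hb : b = a₀
      · subst hb
        rw [hθma₀, pow_zero]
        exact isCoprime_one_right
      · exact (h𝔟copr a₀ b (Ne.symm hb)).pow_right
    exact h𝔟top a₀ (Ideal.isUnit_iff.mp (hcopq.isUnit_of_dvd hdvd))
  -- ### `Am · α ⊆ 𝓞 K`
  have hint : ∀ b ∈ Am, ∃ c : 𝓞 K, algebraMap (𝓞 K) K c = algebraMap (𝓞 K) K b * α := by
    intro b hb
    have h1 : b ^ q * Wp ∈ Ideal.span {Wm} := by
      have h2 : b ^ q * Wp ∈ Am ^ q * Ideal.span {Wp} :=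
        Ideal.mul_mem_mul (Ideal.pow_mem_pow hb q) (Ideal.mem_span_singleton_self _)
      have h3 : Am ^ q * Ideal.span {Wp} ≤ Ideal.span {Wm} := by
        rw [hWpideal, hWmideal, ← mul_assoc, mul_comm (Am ^ q), ]
        exact Ideal.mul_le_right
      exact h3 h2
    obtain ⟨c, hc⟩ := Ideal.mem_span_singleton'.mp h1
    refine IsIntegrallyClosed.exists_algebraMap_eq_of_isIntegral_pow hq.pos ?_
    have : (algebraMap (𝓞 K) K b * α) ^ q = algebraMap (𝓞 K) K c := by
      rw [mul_pow, hαW, ← map_pow, mul_div_assoc', ← map_mul, ← hc, map_mul,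
        mul_div_cancel_right₀ _ (hι0 hWm0)]
    rw [this]
    exact isIntegral_algebraMap
  -- ### `N(Am) · |N(α - 1)| ≥ 1` via the integral ideal `Am (α - 1)`
  have hkey : (1 : ℝ) ≤ (Ideal.absNorm Am : ℝ) * |((Algebra.norm ℚ (α - 1) : ℚ) : ℝ)| := by
    set A : FractionalIdeal (𝓞 K)⁰ K := (Am : FractionalIdeal (𝓞 K)⁰ K) with hAdef
    set J : FractionalIdeal (𝓞 K)⁰ K := A * FractionalIdeal.spanSingleton (𝓞 K)⁰ (α - 1)
      with hJdef
    have hJle : J ≤ 1 := by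
      rw [hJdef, FractionalIdeal.mul_le]
      intro i hi j hj
      rw [hAdef, FractionalIdeal.mem_coeIdeal] at hi
      obtain ⟨b, hb, rfl⟩ := hi
      rw [FractionalIdeal.mem_spanSingleton] at hj
      obtain ⟨r, rfl⟩ := hj
      obtain ⟨c, hc⟩ := hint b hb
      rw [FractionalIdeal.mem_one_iff]
      refine ⟨r * (c - b), ?_⟩
      rw [map_mul, map_sub, hc, Algebra.smul_def]
      ring
    obtain ⟨I₀, hI₀⟩ := FractionalIdeal.le_one_iff_exists_coeIdeal.mp hJle
    have hJ0 : J ≠ 0 := by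
      rw [hJdef]
      refine mul_ne_zero ?_ ?_
      · rw [hAdef, Ne, FractionalIdeal.coeIdeal_eq_zero]; exact hAm0
      · rw [Ne, FractionalIdeal.spanSingleton_eq_zero_iff, sub_eq_zero]; exact hα1
    have hI₀0 : I₀ ≠ ⊥ := by
      rintro rfl
      rw [FractionalIdeal.coeIdeal_bot] at hI₀
      exact hJ0 hI₀.symm
    have hnormJ : FractionalIdeal.absNorm J =
        (Ideal.absNorm Am : ℚ) * |Algebra.norm ℚ (α - 1)| := by
      rw [hJdef, map_mul, hAdef, FractionalIdeal.coeIdeal_absNorm, FractionalIdeal.absNorm_span_singleton]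
    have hnormJ' : FractionalIdeal.absNorm J = Ideal.absNorm I₀ := by
      rw [← hI₀, FractionalIdeal.coeIdeal_absNorm]
    have h1 : (1 : ℚ) ≤ Ideal.absNorm I₀ := by
      have : Ideal.absNorm I₀ ≠ 0 := fun h0 => hI₀0 (Ideal.absNorm_eq_zero_iff.mp h0)
      exact_mod_cast Nat.one_le_iff_ne_zero.mpr this
    rw [← hnormJ', hnormJ] at h1
    have h2 : (((1 : ℚ)) : ℝ) ≤ (((Ideal.absNorm Am : ℚ) * |Algebra.norm ℚ (α - 1)| : ℚ) : ℝ) := by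
      exact_mod_cast h1
    push_cast at h2
    exact h2
  -- ### `|N(α - 1)| ≤ B² 2^(p-3)` with `B = 3/((p-1)(X-1))`
  set B : ℝ := 3 / (((p : ℝ) - 1) * (X - 1)) with hBdef
  have hp5R : (5 : ℝ) ≤ p := by exact_mod_cast hp5
  have hB0 : 0 ≤ B := by
    rw [hBdef]
    exact div_nonneg (by norm_num) (mul_nonneg (by linarith) (by linarith))
  have hnormψ : ∀ ψ : K →+* ℂ, ‖ψ α‖ = 1 := fun ψ =>
    norm_embedding_eq_one_of_pow_eq hζ hx2 θ hanti hq.ne_zero hα ψ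
  have hNub : |((Algebra.norm ℚ (α - 1) : ℚ) : ℝ)| ≤ B ^ 2 * 2 ^ (p - 3) := by
    have hprod := Algebra.norm_eq_prod_embeddings ℚ ℂ (α - 1)
    have hn : ‖(algebraMap ℚ ℂ) (Algebra.norm ℚ (α - 1))‖ =
        |((Algebra.norm ℚ (α - 1) : ℚ) : ℝ)| := by
      rw [eq_ratCast, Complex.norm_ratCast]
    rw [← hn, hprod, norm_prod]
    -- the two embeddings `φ`, `φ̄`
    set ψ₁ : K →ₐ[ℚ] ℂ := φ.toRatAlgHom with hψ₁
    set ψ₂ : K →ₐ[ℚ] ℂ := ((starRingEnd ℂ).comp φ).toRatAlgHom with hψ₂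
    have hψ₁a : ∀ w, ψ₁ w = φ w := fun w => rfl
    have hψ₂a : ∀ w, ψ₂ w = (starRingEnd ℂ) (φ w) := fun w => rfl
    have hne : ψ₁ ≠ ψ₂ := by
      intro heq
      have h1 : (starRingEnd ℂ) (φ ζ) = φ ζ := by rw [← hψ₂a, ← hψ₁a, heq]
      obtain ⟨r, hr⟩ := Complex.conj_eq_iff_real.mp h1
      have hn1 : ‖φ ζ‖ = 1 := (hζ.map_of_injective φ.injective).norm'_eq_one hp.out.ne_zero
      have hr1 : r ^ 2 = 1 := by
        rw [hr, Complex.norm_real, Real.norm_eq_abs] at hn1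
        nlinarith [sq_abs r]
      have hζ2 : ζ ^ 2 = 1 := by
        apply φ.injective
        rw [map_pow, map_one, hr, ← Complex.ofReal_pow, hr1, Complex.ofReal_one]
      have h2 := Nat.le_of_dvd two_pos ((hζ.pow_eq_one_iff_dvd 2).mp hζ2)
      omega
    have hφ' : ‖φ α - 1‖ ≤ B := by rw [hBdef]; exact hφ
    rw [← Finset.prod_mul_prod_compl {ψ₁, ψ₂}]
    have hconj : ‖(starRingEnd ℂ) (φ α) - 1‖ = ‖φ α - 1‖ := by
      rw [← Complex.norm_conj (φ α - 1), map_sub, map_one]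
    have hs : ∏ ψ ∈ ({ψ₁, ψ₂} : Finset (K →ₐ[ℚ] ℂ)), ‖ψ (α - 1)‖ ≤ B ^ 2 := by
      rw [Finset.prod_pair hne, hψ₁a, hψ₂a, map_sub, map_one, map_sub, map_one, hconj, sq]
      exact mul_le_mul hφ' hφ' (norm_nonneg _) hB0
    have hc : ∏ ψ ∈ ({ψ₁, ψ₂} : Finset (K →ₐ[ℚ] ℂ))ᶜ, ‖ψ (α - 1)‖ ≤ 2 ^ (p - 3) := by
      have hcard : (({ψ₁, ψ₂} : Finset (K →ₐ[ℚ] ℂ))ᶜ).card = p - 3 := by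
        rw [Finset.card_compl, Finset.card_pair hne, AlgHom.card, hrank]
        omega
      rw [← hcard, ← prod_const]
      refine prod_le_prod (fun ψ _ => norm_nonneg _) fun ψ _ => ?_
      have h1 : ‖ψ α‖ = 1 := hnormψ ψ.toRingHom
      calc ‖ψ (α - 1)‖ = ‖ψ α - 1‖ := by rw [map_sub, map_one]
        _ ≤ ‖ψ α‖ + ‖(1 : ℂ)‖ := norm_sub_le _ _
        _ = 2 := by rw [h1, norm_one]; norm_num
    exact mul_le_mul hs hc (prod_nonneg fun _ _ => norm_nonneg _) (sq_nonneg _)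
  -- ### `N(Am)^q ≤ (X+1)^((p-1) H)`
  have hAmq : (Ideal.absNorm Am : ℝ) ^ q ≤ (X + 1) ^ ((p - 1) * H) := by
    have h1 : (Ideal.absNorm (Ideal.span {Wm}) : ℝ) = (p : ℝ) ^ H * (Ideal.absNorm Am : ℝ) ^ q := by
      rw [hWmideal, map_mul, map_pow, map_pow, h𝔭norm]
      push_cast
      ring
    have h2 : (Ideal.absNorm (Ideal.span {Wm}) : ℝ) ≤ (X + 1) ^ ((p - 1) * H) := by
      rw [hWmdef, ← Ideal.prod_span_singleton]
      simp_rw [← Ideal.span_singleton_pow]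
      rw [map_prod]
      simp_rw [map_pow]
      push_cast
      calc ∏ a, (Ideal.absNorm (Ideal.span {(x : 𝓞 K) - z ^ m a}) : ℝ) ^ θm a
          ≤ ∏ a, ((X + 1) ^ (p - 1)) ^ θm a :=
            prod_le_prod (fun a _ => pow_nonneg (Nat.cast_nonneg _) _)
              fun a _ => pow_le_pow_left₀ (Nat.cast_nonneg _) (hνle a) _
        _ = (X + 1) ^ ((p - 1) * H) := by rw [prod_pow_eq_pow_sum, ← pow_mul, hHdef]
    have h3 : (Ideal.absNorm Am : ℝ) ^ q ≤ (p : ℝ) ^ H * (Ideal.absNorm Am : ℝ) ^ q :=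
      le_mul_of_one_le_left (pow_nonneg (Nat.cast_nonneg _) _)
        (one_le_pow₀ (by linarith))
    linarith
  -- ### the final inequality
  set n : ℝ := (Ideal.absNorm Am : ℝ) with hndef
  set C : ℝ := B ^ 2 * 2 ^ (p - 3) with hCdef
  have hn0 : 0 ≤ n := Nat.cast_nonneg _
  have hC0 : 0 ≤ C := by rw [hCdef]; positivity
  clear_value C n
  have hX1 : (1 : ℝ) ≤ X + 1 := by linarith only [hX10]
  have h1 : 1 ≤ n * C := hkey.trans (mul_le_mul_of_nonneg_left hNub hn0)
  have h2 : (1 : ℝ) ≤ (n * C) ^ (2 * q) := one_le_pow₀ h1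
  have h3 : n ^ (2 * q) ≤ (X + 1) ^ (3 * q) := by
    calc n ^ (2 * q) = (n ^ q) ^ 2 := by rw [mul_comm, pow_mul]
      _ ≤ ((X + 1) ^ ((p - 1) * H)) ^ 2 := pow_le_pow_left₀ (pow_nonneg hn0 _) hAmq 2
      _ = (X + 1) ^ (2 * (p - 1) * H) := by rw [← pow_mul]; ring_nf
      _ ≤ (X + 1) ^ (3 * q) := pow_le_pow_right₀ hX1 hHq
  have h4 : (1 : ℝ) ≤ ((X + 1) ^ 3 * C ^ 2) ^ q := by
    calc (1 : ℝ) ≤ (n * C) ^ (2 * q) := h2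
      _ = n ^ (2 * q) * C ^ (2 * q) := mul_pow _ _ _
      _ ≤ (X + 1) ^ (3 * q) * C ^ (2 * q) := mul_le_mul_of_nonneg_right h3 (pow_nonneg hC0 _)
      _ = ((X + 1) ^ 3 * C ^ 2) ^ q := by rw [mul_pow, ← pow_mul, ← pow_mul]
  have h5 : (1 : ℝ) ≤ (X + 1) ^ 3 * C ^ 2 :=
    (one_le_pow_iff_of_nonneg (by positivity) hq.ne_zero).mp h4
  -- numerics: `Y = X - 1 ≥ 16 · 4^(p-3)`, `P1 = p - 1 ≥ 4`, `B · P1 · Y = 3`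
  have hFp : ((2 : ℝ) ^ (p - 3)) ^ 2 = (4 : ℝ) ^ (p - 3) := by
    rw [← pow_mul, mul_comm, pow_mul]; norm_num
  have h16 : (4 : ℝ) ^ (p - 1) = 16 * 4 ^ (p - 3) := by
    rw [show p - 1 = p - 3 + 2 by omega, pow_add]; norm_num; ring
  have hBPY : B * (((p : ℝ) - 1) * (X - 1)) = 3 := by
    rw [hBdef]
    exact div_mul_cancel₀ _ (mul_ne_zero (by linarith only [hp5R]) (by linarith only [hX10]))
  rw [hCdef, show X + 1 = X - 1 + 2 by ring] at h5
  exact minusArgument_numeric hp5R (by linarith only [hX10]) (by positivity)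
    (by linarith only [hXq, h16]) hBPY hFp h5

end MinusArgument






end Catalan

end Literature.NumberTheory.DiophantineGeometry
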